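import Mathlib
import HarnessLib
import Summits.AtomisticToContinuum.Crystallization.Theorems.PricedLinkCensusSoftFourRingsPathFamily
import Summits.AtomisticToContinuum.Crystallization.Theorems.PricedLinkCensusSoftFourRingsBondFacet
import Summits.AtomisticToContinuum.Crystallization.Theorems.PricedLinkCensusSoftFourRingsSlackFacet
import Summits.AtomisticToContinuum.Crystallization.Theorems.PricedLinkCensusSoftFourRingsGlobal

/-!
# Soft four-rings: small helpers for the local structure of slack triangles

Support file for `SoftFourRings` (route `PricedLinkCensus`, sub-problem `Crystallization`).
Bond-level (`B` = family of bond pairs) and facet-level bookkeeping lemmas used by the analysis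
of the vertices of a slack triangle: distinctness from cardinalities, bond triangles are
`nb = 0` facets, sides and `nb`, the partners of a vertex, lower bounds for `t_v`.
-/

namespace Summit.AtomisticToContinuum.Crystallization.Theorems

open Real RealInnerProductSpace Literature.Geometry.DiscreteGeometry

/-- Three points spanning a three-element `Finset` are distinct. -/
theorem card_three_distinct {α : Type*} [DecidableEq α] {a b c : α}
    (h : ({a, b, c} : Finset α).card = 3) : a ≠ b ∧ a ≠ c ∧ b ≠ c := by
  refine ⟨?_, ?_, ?_⟩
  · rintro rfl
    have : ({a, a, c} : Finset α) = {a, c} := by ext x; simp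
    rw [this] at h
    exact absurd h (by have := Finset.card_le_two (a := a) (b := c); omega)
  · rintro rfl
    have : ({a, b, a} : Finset α) = {a, b} := by ext x; simp; tauto
    rw [this] at h
    exact absurd h (by have := Finset.card_le_two (a := a) (b := b); omega)
  · rintro rfl
    have : ({a, b, b} : Finset α) = {a, b} := by ext x; simp
    rw [this] at h
    exact absurd h (by have := Finset.card_le_two (a := a) (b := b); omega)

/-- A three-element `Finset` equals any three distinct members. -/
theorem eq_three_of_mem_of_card {α : Type*} [DecidableEq α] {T : Finset α} (h3 : T.card = 3)
    {x y z : α} (hx : x ∈ T) (hy : y ∈ T) (hz : z ∈ T) (hxy : x ≠ y) (hxz : x ≠ z)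
    (hyz : y ≠ z) : T = {x, y, z} := by
  symm
  apply Finset.eq_of_subset_of_card_le
  · intro w hw
    rw [Finset.mem_insert, Finset.mem_insert, Finset.mem_singleton] at hw
    rcases hw with rfl | rfl | rfl
    exacts [hx, hy, hz]
  · rw [h3, Finset.card_eq_three.2 ⟨x, y, z, hxy, hxz, hyz, rfl⟩]

/-- Non-membership in a three-element `Finset`. -/
theorem not_mem_three {α : Type*} [DecidableEq α] {x p q r : α} (h1 : x ≠ p) (h2 : x ≠ q)
    (h3 : x ≠ r) : x ∉ ({p, q, r} : Finset α) := by
  simp [h1, h2, h3]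

section Setting

variable {X : Finset (EuclideanSpace ℝ (Fin 3))} {B : Finset (Finset (EuclideanSpace ℝ (Fin 3)))}
  (hX1 : ∀ y ∈ X, ‖y‖ = 1)
  (h0 : (0 : EuclideanSpace ℝ (Fin 3)) ∈
    interior (convexHull ℝ (X : Set (EuclideanSpace ℝ (Fin 3)))))
  (hsepX : ∀ u ∈ X, ∀ u' ∈ X, u ≠ u' → ⟪u, u'⟫ ≤ 1 - 1 / (2 * (101 / 100 : ℝ) ^ 2))
  (hB : ∀ T ∈ B, ∃ u ∈ X, ∃ u' ∈ X, u ≠ u' ∧ 1 - (101 / 100 : ℝ) ^ 2 / 2 ≤ ⟪u, u'⟫ ∧ T = {u, u'})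
  (hdeg : ∀ v ∈ X, ∃ w : Fin 4 → EuclideanSpace ℝ (Fin 3), (∀ k, w k ∈ X) ∧
    Function.Injective w ∧ (∀ k, w k ≠ v) ∧
    (∀ k, ({v, w k} : Finset (EuclideanSpace ℝ (Fin 3))) ∈ B) ∧
    ∀ y, ({v, y} : Finset (EuclideanSpace ℝ (Fin 3))) ∈ B → ∃ k, y = w k)

include hB in
/-- Membership of the endpoints of a bond. -/
theorem mem_of_mem_bonds {a b : EuclideanSpace ℝ (Fin 3)}
    (h : ({a, b} : Finset (EuclideanSpace ℝ (Fin 3))) ∈ B) : a ∈ X ∧ b ∈ X :=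
  let h' := close_of_pair_mem_bonds hB h (ne_of_mem_bonds hB h)
  ⟨h'.1, h'.2.1⟩

include hX1 hsepX hB in
open scoped Classical in
/-- **A bond triangle is a facet with `nb = 0`** and tight set exactly the triangle. -/
theorem bt_facet_of_bonds {u v w : EuclideanSpace ℝ (Fin 3)}
    (huv : ({u, v} : Finset (EuclideanSpace ℝ (Fin 3))) ∈ B)
    (hvw : ({v, w} : Finset (EuclideanSpace ℝ (Fin 3))) ∈ B)
    (huw : ({u, w} : Finset (EuclideanSpace ℝ (Fin 3))) ∈ B) :
    ∃ c ∈ facetNormals X, tightSet X c = {u, v, w} ∧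
      ((edgesOfFacet X c).filter (fun T => T ∉ B)).card = 0 := by
  have huv' := close_of_pair_mem_bonds hB huv (ne_of_mem_bonds hB huv)
  have hvw' := close_of_pair_mem_bonds hB hvw (ne_of_mem_bonds hB hvw)
  have huw' := close_of_pair_mem_bonds hB huw (ne_of_mem_bonds hB huw)
  obtain ⟨c, hcF, hcT, -, -⟩ := bond_triangle_facet_one_percent hX1 hsepX huv'.1 huv'.2.1 hvw'.2.1
    (ne_of_mem_bonds hB huv) (ne_of_mem_bonds hB huw) (ne_of_mem_bonds hB hvw) huv'.2.2 huw'.2.2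
    hvw'.2.2
  refine ⟨c, hcF, hcT, ?_⟩
  rw [Finset.card_eq_zero, Finset.filter_eq_empty_iff]
  intro T hT
  rw [not_not]
  unfold edgesOfFacet at hT
  obtain ⟨hTH, hTsub⟩ := Finset.mem_filter.1 hT
  rw [hcT] at hTsub
  obtain ⟨p, q, hpq, rfl⟩ := Finset.card_eq_two.1 (card_eq_two_of_mem_hullEdges hTH)
  have hp : p ∈ ({u, v, w} : Finset (EuclideanSpace ℝ (Fin 3))) :=
    hTsub (Finset.mem_insert_self _ _)
  have hq : q ∈ ({u, v, w} : Finset (EuclideanSpace ℝ (Fin 3))) :=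
    hTsub (Finset.mem_insert_of_mem (Finset.mem_singleton_self _))
  rw [Finset.mem_insert, Finset.mem_insert, Finset.mem_singleton] at hp hq
  rcases hp with rfl | rfl | rfl <;> rcases hq with rfl | rfl | rfl
  · exact absurd rfl hpq
  · exact huv
  · exact huw
  · rw [Finset.pair_comm]; exact huv
  · exact absurd rfl hpq
  · exact hvw
  · rw [Finset.pair_comm]; exact huw
  · rw [Finset.pair_comm]; exact hvw
  · exact absurd rfl hpq

omit hX1 h0 hsepX hB hdeg in
open scoped Classical in
/-- A facet containing `T` in its tight set is a facet through the hull edge `T`. -/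
theorem mem_facetsOfEdge_of_subset {T : Finset (EuclideanSpace ℝ (Fin 3))}
    {c : EuclideanSpace ℝ (Fin 3)} (hcF : c ∈ facetNormals X) (hT : T ⊆ tightSet X c) :
    c ∈ facetsOfEdge X T := by
  unfold facetsOfEdge
  exact Finset.mem_filter.2 ⟨hcF, hT⟩

omit hX1 h0 hsepX hB hdeg in
open scoped Classical in
/-- A hull edge with both endpoints tight is a side of the facet. -/
theorem pair_mem_edgesOfFacet {c x y : EuclideanSpace ℝ (Fin 3)}
    (hH : ({x, y} : Finset (EuclideanSpace ℝ (Fin 3))) ∈ hullEdges X) (hx : x ∈ tightSet X c)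
    (hy : y ∈ tightSet X c) : ({x, y} : Finset (EuclideanSpace ℝ (Fin 3))) ∈ edgesOfFacet X c := by
  unfold edgesOfFacet
  refine Finset.mem_filter.2 ⟨hH, ?_⟩
  intro z hz
  rw [Finset.mem_insert, Finset.mem_singleton] at hz
  rcases hz with rfl | rfl
  exacts [hx, hy]

omit hX1 h0 hsepX hB hdeg in
open scoped Classical in
/-- Two distinct non-bond sides give `nb ≥ 2`. -/
theorem two_le_nb_of_sides {c : EuclideanSpace ℝ (Fin 3)} {T₁ T₂ : Finset (EuclideanSpace ℝ (Fin 3))}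
    (h₁ : T₁ ∈ edgesOfFacet X c) (h₂ : T₂ ∈ edgesOfFacet X c) (hB₁ : T₁ ∉ B) (hB₂ : T₂ ∉ B)
    (hne : T₁ ≠ T₂) : 2 ≤ ((edgesOfFacet X c).filter (fun T => T ∉ B)).card := by
  change 1 < _
  rw [Finset.one_lt_card]
  exact ⟨T₁, Finset.mem_filter.2 ⟨h₁, hB₁⟩, T₂, Finset.mem_filter.2 ⟨h₂, hB₂⟩, hne⟩

omit hX1 h0 hsepX hB hdeg in
open scoped Classical in
/-- One non-bond side gives `nb ≥ 1`. -/
theorem one_le_nb_of_side {c : EuclideanSpace ℝ (Fin 3)} {T₁ : Finset (EuclideanSpace ℝ (Fin 3))}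
    (h₁ : T₁ ∈ edgesOfFacet X c) (hB₁ : T₁ ∉ B) :
    1 ≤ ((edgesOfFacet X c).filter (fun T => T ∉ B)).card :=
  Finset.card_pos.2 ⟨T₁, Finset.mem_filter.2 ⟨h₁, hB₁⟩⟩

include hX1 h0 in
open scoped Classical in
/-- **In a triangle with `nb = 1`, the two sides other than the non-bond one are bonds.** -/
theorem mem_bonds_of_nb_one {c x y z : EuclideanSpace ℝ (Fin 3)} (hcF : c ∈ facetNormals X)
    (hT : tightSet X c = {x, y, z}) (h3 : (tightSet X c).card = 3)
    (hnb : ((edgesOfFacet X c).filter (fun T => T ∉ B)).card = 1)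
    (hxy : ({x, y} : Finset (EuclideanSpace ℝ (Fin 3))) ∉ B) :
    ({x, z} : Finset (EuclideanSpace ℝ (Fin 3))) ∈ B ∧
      ({y, z} : Finset (EuclideanSpace ℝ (Fin 3))) ∈ B := by
  have hd := card_three_distinct (hT ▸ h3)
  have hx : x ∈ tightSet X c := by rw [hT]; simp
  have hy : y ∈ tightSet X c := by rw [hT]; simp
  have hz : z ∈ tightSet X c := by rw [hT]; simp
  have hsxy := pair_mem_edgesOfFacet_of_card_three hX1 h0 hcF h3 hx hy hd.1
  have hsxz := pair_mem_edgesOfFacet_of_card_three hX1 h0 hcF h3 hx hz hd.2.1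
  have hsyz := pair_mem_edgesOfFacet_of_card_three hX1 h0 hcF h3 hy hz hd.2.2
  constructor
  · by_contra h
    have := two_le_nb_of_sides (B := B) hsxy hsxz hxy h (fun h' => by
      have : y ∈ ({x, z} : Finset (EuclideanSpace ℝ (Fin 3))) := by rw [← h']; simp
      rw [Finset.mem_insert, Finset.mem_singleton] at this
      rcases this with h'' | h''
      exacts [hd.1 h''.symm, hd.2.2 h''])
    omega
  · by_contra h
    have := two_le_nb_of_sides (B := B) hsxy hsyz hxy h (fun h' => by
      have : x ∈ ({y, z} : Finset (EuclideanSpace ℝ (Fin 3))) := by rw [← h']; simp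
      rw [Finset.mem_insert, Finset.mem_singleton] at this
      rcases this with h'' | h''
      exacts [hd.1 h'', hd.2.1 h''])
    omega

include hdeg in
/-- **Four distinct partners are all the partners.** -/
theorem partners_iff_of_four {v : EuclideanSpace ℝ (Fin 3)} (hv : v ∈ X)
    (y : Fin 4 → EuclideanSpace ℝ (Fin 3)) (hyinj : Function.Injective y)
    (hy : ∀ k, ({v, y k} : Finset (EuclideanSpace ℝ (Fin 3))) ∈ B) (z : EuclideanSpace ℝ (Fin 3)) :
    ({v, z} : Finset (EuclideanSpace ℝ (Fin 3))) ∈ B ↔ ∃ k, z = y k := by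
  obtain ⟨w, -, hwinj, -, hvw, hvonly⟩ := hdeg v hv
  -- `y = w ∘ σ` for an injective, hence bijective, `σ`
  have hσ : ∀ k, ∃ m, y k = w m := fun k => hvonly _ (hy k)
  choose σ hσ using hσ
  have hσinj : Function.Injective σ := fun k k' h => hyinj (by rw [hσ k, hσ k', h])
  have hσsurj : Function.Surjective σ := Finite.surjective_of_injective hσinj
  constructor
  · intro hz
    obtain ⟨m, rfl⟩ := hvonly z hz
    obtain ⟨k, rfl⟩ := hσsurj m
    exact ⟨k, (hσ k).symm⟩
  · rintro ⟨k, rfl⟩; exact hy k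

include hdeg in
/-- **No vertex has five distinct partners.** -/
theorem five_partners_false {v : EuclideanSpace ℝ (Fin 3)} (hv : v ∈ X)
    (y : Fin 5 → EuclideanSpace ℝ (Fin 3)) (hyinj : Function.Injective y)
    (hy : ∀ k, ({v, y k} : Finset (EuclideanSpace ℝ (Fin 3))) ∈ B) : False := by
  obtain ⟨w, -, -, -, -, hvonly⟩ := hdeg v hv
  have hσ : ∀ k, ∃ m, y k = w m := fun k => hvonly _ (hy k)
  choose σ hσ using hσ
  have hσinj : Function.Injective σ := fun k k' h => hyinj (by rw [hσ k, hσ k', h])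
  have := Fintype.card_le_of_injective σ hσinj
  simp at this

omit hX1 h0 hsepX hB hdeg in
open scoped Classical in
/-- **Lower bound for `t_v`** from an explicit set of bond-triangle facets at `v`. -/
theorem le_tv_of_subset {v : EuclideanSpace ℝ (Fin 3)} {S : Finset (EuclideanSpace ℝ (Fin 3))}
    (hS : ∀ c ∈ S, c ∈ facetNormals X ∧ v ∈ tightSet X c ∧ (tightSet X c).card = 3 ∧
      ((edgesOfFacet X c).filter (fun T => T ∉ B)).card = 0) :
    S.card ≤ ((facetNormals X).filter (fun c => v ∈ tightSet X c ∧ (tightSet X c).card = 3 ∧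
      ((edgesOfFacet X c).filter (fun T => T ∉ B)).card = 0)).card := by
  refine Finset.card_le_card fun c hc => ?_
  obtain ⟨h1, h2, h3, h4⟩ := hS c hc
  exact Finset.mem_filter.2 ⟨h1, h2, h3, h4⟩

include hX1 hsepX hB in
open scoped Classical in
/-- A bond triangle `{v, y, z}` yields a bond-triangle facet at `v` with that tight set. -/
theorem exists_bt_at {v y z : EuclideanSpace ℝ (Fin 3)}
    (hvy : ({v, y} : Finset (EuclideanSpace ℝ (Fin 3))) ∈ B)
    (hyz : ({y, z} : Finset (EuclideanSpace ℝ (Fin 3))) ∈ B)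
    (hvz : ({v, z} : Finset (EuclideanSpace ℝ (Fin 3))) ∈ B) :
    ∃ c, (c ∈ facetNormals X ∧ v ∈ tightSet X c ∧ (tightSet X c).card = 3 ∧
      ((edgesOfFacet X c).filter (fun T => T ∉ B)).card = 0) ∧ tightSet X c = {v, y, z} := by
  obtain ⟨c, hcF, hcT, hnb⟩ := bt_facet_of_bonds hX1 hsepX hB hvy hyz hvz
  refine ⟨c, ⟨hcF, by rw [hcT]; simp, ?_, hnb⟩, hcT⟩
  rw [hcT]
  exact Finset.card_eq_three.2 ⟨v, y, z, ne_of_mem_bonds hB hvy, ne_of_mem_bonds hB hvz,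
    ne_of_mem_bonds hB hyz, rfl⟩

omit hX1 h0 hsepX hB hdeg in
/-- **Reversing a path family.** -/
theorem path_family_rev {c : EuclideanSpace ℝ (Fin 3)} (w : Fin 4 → EuclideanSpace ℝ (Fin 3))
    (hwX : ∀ k, w k ∈ X) (hwinj : Function.Injective w) (hwv : ∀ k, w k ≠ c)
    (hvw : ∀ k, ({c, w k} : Finset (EuclideanSpace ℝ (Fin 3))) ∈ B)
    (hvonly : ∀ y, ({c, y} : Finset (EuclideanSpace ℝ (Fin 3))) ∈ B → ∃ k, y = w k)
    (hB01 : ({w 0, w 1} : Finset (EuclideanSpace ℝ (Fin 3))) ∈ B)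
    (hB12 : ({w 1, w 2} : Finset (EuclideanSpace ℝ (Fin 3))) ∈ B)
    (hB23 : ({w 2, w 3} : Finset (EuclideanSpace ℝ (Fin 3))) ∈ B) :
    (∀ k, (w ∘ Fin.rev) k ∈ X) ∧ Function.Injective (w ∘ Fin.rev) ∧ (∀ k, (w ∘ Fin.rev) k ≠ c) ∧
      (∀ k, ({c, (w ∘ Fin.rev) k} : Finset (EuclideanSpace ℝ (Fin 3))) ∈ B) ∧
      (∀ y, ({c, y} : Finset (EuclideanSpace ℝ (Fin 3))) ∈ B → ∃ k, y = (w ∘ Fin.rev) k) ∧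
      ({(w ∘ Fin.rev) 0, (w ∘ Fin.rev) 1} : Finset (EuclideanSpace ℝ (Fin 3))) ∈ B ∧
      ({(w ∘ Fin.rev) 1, (w ∘ Fin.rev) 2} : Finset (EuclideanSpace ℝ (Fin 3))) ∈ B ∧
      ({(w ∘ Fin.rev) 2, (w ∘ Fin.rev) 3} : Finset (EuclideanSpace ℝ (Fin 3))) ∈ B ∧
      (w ∘ Fin.rev) 0 = w 3 ∧ (w ∘ Fin.rev) 3 = w 0 ∧ (w ∘ Fin.rev) 1 = w 2 ∧
      (w ∘ Fin.rev) 2 = w 1 := by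
  have h0 : (w ∘ Fin.rev) 0 = w 3 := by simp [Fin.rev]
  have h1 : (w ∘ Fin.rev) 1 = w 2 := by
    show w (Fin.rev 1) = w 2; congr 1
  have h2 : (w ∘ Fin.rev) 2 = w 1 := by
    show w (Fin.rev 2) = w 1; congr 1
  have h3 : (w ∘ Fin.rev) 3 = w 0 := by
    show w (Fin.rev 3) = w 0; congr 1
  refine ⟨fun k => hwX _, hwinj.comp Fin.rev_injective, fun k => hwv _, fun k => hvw _, ?_, ?_, ?_,
    ?_, h0, h3, h1, h2⟩
  · intro y hy
    obtain ⟨k, rfl⟩ := hvonly y hy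
    exact ⟨Fin.rev k, by simp⟩
  · rw [h0, h1, Finset.pair_comm]; exact hB23
  · rw [h1, h2, Finset.pair_comm]; exact hB12
  · rw [h2, h3, Finset.pair_comm]; exact hB01

end Setting

end Summit.AtomisticToContinuum.Crystallization.Theorems
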